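import Literature.NumberTheory.NumberFields.SqrtGeneratorUnramified
import Mathlib.NumberTheory.RamificationInertia.Galois
import Mathlib.NumberTheory.RamificationInertia.Basic
import Mathlib.NumberTheory.NumberField.Ideal.Basic
import Mathlib.Data.Set.Card.Arithmetic
import HarnessLib

/-!
# Ramified primes of a quadratic extension `E = F(√m)`: they divide `4m`, hence lie over the prime factors of any integer multiple of
# `4m`, and there are at most `[F : F₀] · Σ_ℓ #{primes of F₀ over ℓ}` of them (proved; no definition, no named fact)

`Proofs`-style file (theorems only) in topic `NumberTheory/NumberFields` (namespace `Literature.NumberTheory.NumberFields`), written by the prover seat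
`cruxlead-stmt-BirchSwinnertonDyer-19573-w2` GEN 7 (cell `bsd-2adic`; `--supports` stmt-BirchSwinnertonDyer-19573). Module (E4) of the seat's «Iwasawa
ℓ = 2 ascent with real places»: the per-layer bound on the number of ramified primes (hypothesis `hram` of
`IwasawaTheory.classicalMuVanishes_restrict_of_quadratic_of_signVec_surjective`) for the layers `A_n = K·ℚ_n ⊆ B_n = A_n(√m)`.

* `ramificationIdxIn_eq_one_of_not_mem` — `E/F` Galois, `x ∈ 𝓞_E`, `x² = m ∈ 𝓞_F`, `E = F(x)`: a prime `v` of `F` with `4m ∉ v` is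
  unramified in `E` (tree `isUnramifiedAt_of_sq_eq`, Neukirch III (2.6), at every prime above `v`).
* `ncard_ramified_le_ncard_mem` — so the ramified primes are among `{v | 4m ∈ v}`.
* `ncard_setOf_mem_le_sum_primesOver` — if `a ∣ N` in `𝓞_F` for an integer `N ≠ 0`, the primes containing `a` lie over the prime factors
  of `N`: `#{v | a ∈ v} ≤ Σ_{ℓ ∣ N} #{primes of F over ℓ}`.
* `ncard_primesOver_le_finrank_mul` — `F₀ ⊆ F`: `#{primes of F over ℓ} ≤ [F : F₀] · #{primes of F₀ over ℓ}` (Mathlib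
  `Ideal.card_primesOverFinset_le_finrank` fibrewise).

References: [NeukirchANT1999] Ch. III (2.6) (different and discriminant of `F(√m)`), Ch. I §8 (fundamental identity `Σ eᵢfᵢ = n`);
[Washington1997] §13.1.
-/

set_option autoImplicit false

noncomputable section

open scoped NumberField Classical
open NumberField IsDedekindDomain

namespace Literature.NumberTheory.NumberFields

/-! ## §1 Unramified away from `4m` -/

/-- **A prime `v ∌ 4m` of `F` is unramified in `E = F(√m)`** (`E/F` Galois; `e_v = e(Q|v)` for any `Q`, and `Q ∌ 4m` is unramified by
`isUnramifiedAt_of_sq_eq`). [cite: NeukirchANT1999, Ch. III (2.6)] -/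
theorem ramificationIdxIn_eq_one_of_not_mem {F E : Type*} [Field F] [NumberField F] [Field E] [NumberField E] [Algebra F E]
    [IsGalois F E] {x : 𝓞 E} {m : 𝓞 F} (hx : x ^ 2 = algebraMap (𝓞 F) (𝓞 E) m) (hgen : Algebra.adjoin F {(x : E)} = ⊤)
    (v : HeightOneSpectrum (𝓞 F)) (hv : 4 * m ∉ v.asIdeal) : v.asIdeal.ramificationIdxIn (𝓞 E) = 1 := by
  obtain ⟨Q, hQmax, hQv⟩ := Ideal.exists_maximal_ideal_liesOver_of_isIntegral (S := 𝓞 E) v.asIdeal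
  haveI := hQmax
  haveI := hQv
  have hQ : algebraMap (𝓞 F) (𝓞 E) (4 * m) ∉ Q := by
    intro h
    apply hv
    have h' : 4 * m ∈ Q.under (𝓞 F) := Ideal.mem_comap.mpr h
    rwa [← hQv.over] at h'
  haveI : Algebra.IsUnramifiedAt (𝓞 F) Q := isUnramifiedAt_of_sq_eq hx hgen Q hQ
  rw [Ideal.ramificationIdxIn_eq_ramificationIdx v.asIdeal Q (E ≃ₐ[F] E)]
  exact Ideal.ramificationIdx_eq_one_of_isUnramifiedAt

/-- **The ramified primes of `F` in `E = F(√m)` are among the primes containing `4m`.** [cite: NeukirchANT1999, Ch. III (2.6)] -/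
theorem ncard_ramified_le_ncard_mem {F E : Type*} [Field F] [NumberField F] [Field E] [NumberField E] [Algebra F E]
    [IsGalois F E] {x : 𝓞 E} {m : 𝓞 F} (hx : x ^ 2 = algebraMap (𝓞 F) (𝓞 E) m) (hgen : Algebra.adjoin F {(x : E)} = ⊤)
    (hm : m ≠ 0) :
    {v : HeightOneSpectrum (𝓞 F) | v.asIdeal.ramificationIdxIn (𝓞 E) ≠ 1}.ncard ≤
      {v : HeightOneSpectrum (𝓞 F) | 4 * m ∈ v.asIdeal}.ncard := by
  refine Set.ncard_le_ncard (fun v hv ↦ ?_) ?_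
  · by_contra h4
    exact hv (ramificationIdxIn_eq_one_of_not_mem hx hgen v h4)
  · have h0 : Ideal.span {4 * m} ≠ (⊥ : Ideal (𝓞 F)) := by
      rw [Ne, Ideal.span_singleton_eq_bot]
      exact mul_ne_zero (by norm_num) hm
    refine (Ideal.finite_factors h0).subset fun v hv ↦ ?_
    simp only [Set.mem_setOf_eq] at hv ⊢
    exact Ideal.dvd_iff_le.mpr ((Ideal.span_singleton_le_iff_mem _).mpr hv)

/-! ## §2 Primes containing a divisor of an integer -/

/-- A prime `v` of `𝓞_F` containing the non-zero integer `N` lies over a prime factor `ℓ` of `N`. [cite: NeukirchANT1999, Ch. I §8] -/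
theorem exists_mem_primeFactors_liesOver {F : Type*} [Field F] [NumberField F] {N : ℤ} (hN : N ≠ 0)
    (v : HeightOneSpectrum (𝓞 F)) (hNv : ((N : ℤ) : 𝓞 F) ∈ v.asIdeal) :
    ∃ ℓ ∈ N.natAbs.primeFactors, v.asIdeal ∈ (Ideal.span {(ℓ : ℤ)}).primesOver (𝓞 F) := by
  haveI := v.isMaximal
  set P : Ideal ℤ := v.asIdeal.under ℤ with hP
  have hPspan : Ideal.span {((Ideal.absNorm P : ℕ) : ℤ)} = P := Int.ideal_span_absNorm_eq_self P
  set ℓ : ℕ := Ideal.absNorm P with hℓ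
  have hNP : N ∈ P := by
    rw [hP, Ideal.under_def, Ideal.mem_comap]
    simpa using hNv
  have hℓN : (ℓ : ℤ) ∣ N := by
    rw [← Ideal.mem_span_singleton, hPspan]; exact hNP
  haveI hPprime : P.IsPrime := Ideal.IsPrime.under ℤ v.asIdeal
  have hℓ0 : ℓ ≠ 0 := by
    intro h0
    have : P = ⊥ := by rw [← hPspan, h0]; simp
    rw [this] at hNP
    exact hN ((Submodule.mem_bot ℤ).mp hNP)
  have hℓprime : ℓ.Prime := by
    have hsp : (Ideal.span {((ℓ : ℕ) : ℤ)}).IsPrime := by rw [hPspan]; exact hPprime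
    have h := (Ideal.span_singleton_prime (by exact_mod_cast hℓ0)).mp hsp
    exact Int.prime_iff_natAbs_prime.mp h
  refine ⟨ℓ, Nat.mem_primeFactors.mpr ⟨hℓprime, ?_, Int.natAbs_ne_zero.mpr hN⟩, v.isPrime, ⟨?_⟩⟩
  · exact Int.natAbs_dvd_natAbs.mpr hℓN |>.trans (by simp)
  · rw [hPspan]

/-- **`#{v | a ∈ v} ≤ Σ_{ℓ ∣ N} #{primes over ℓ}`** when `a ∣ N` in `𝓞_F`, `N` a non-zero integer: a prime `v ∋ a` contains `N` and lies over a
prime factor of `N`. [cite: NeukirchANT1999, Ch. I §8 (primes above a rational prime)] -/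
theorem ncard_setOf_mem_le_sum_primesOver {F : Type*} [Field F] [NumberField F] {a : 𝓞 F} {N : ℤ} (hN : N ≠ 0)
    (haN : a ∣ (N : 𝓞 F)) :
    {v : HeightOneSpectrum (𝓞 F) | a ∈ v.asIdeal}.ncard ≤
      ∑ ℓ ∈ N.natAbs.primeFactors, ((Ideal.span {(ℓ : ℤ)}).primesOver (𝓞 F)).ncard := by
  have hcover : {v : HeightOneSpectrum (𝓞 F) | a ∈ v.asIdeal} ⊆
      ⋃ ℓ : N.natAbs.primeFactors, {v : HeightOneSpectrum (𝓞 F) | v.asIdeal ∈ (Ideal.span {((ℓ : ℕ) : ℤ)}).primesOver (𝓞 F)} := by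
    intro v hv
    simp only [Set.mem_setOf_eq] at hv
    have hNv : ((N : ℤ) : 𝓞 F) ∈ v.asIdeal := by
      obtain ⟨c, hc⟩ := haN
      rw [hc]; exact v.asIdeal.mul_mem_right c hv
    obtain ⟨ℓ, hℓ, hvℓ⟩ := exists_mem_primeFactors_liesOver hN v hNv
    exact Set.mem_iUnion.mpr ⟨⟨ℓ, hℓ⟩, hvℓ⟩
  have hmax : ∀ ℓ : N.natAbs.primeFactors, (Ideal.span {((ℓ : ℕ) : ℤ)}).IsMaximal := fun ℓ ↦
    haveI : Fact (ℓ : ℕ).Prime := ⟨Nat.prime_of_mem_primeFactors ℓ.2⟩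
    Int.ideal_span_isMaximal_of_prime (ℓ : ℕ)
  have hfin : ∀ ℓ : N.natAbs.primeFactors,
      {v : HeightOneSpectrum (𝓞 F) | v.asIdeal ∈ (Ideal.span {((ℓ : ℕ) : ℤ)}).primesOver (𝓞 F)}.Finite := fun ℓ ↦ by
    haveI := hmax ℓ
    exact ((IsDedekindDomain.primesOver_finite _ _).preimage fun v _ v' _ h ↦ HeightOneSpectrum.ext h)
  have hle : ∀ ℓ : N.natAbs.primeFactors,
      {v : HeightOneSpectrum (𝓞 F) | v.asIdeal ∈ (Ideal.span {((ℓ : ℕ) : ℤ)}).primesOver (𝓞 F)}.ncard ≤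
        ((Ideal.span {((ℓ : ℕ) : ℤ)}).primesOver (𝓞 F)).ncard := fun ℓ ↦ by
    haveI := hmax ℓ
    exact Set.ncard_le_ncard_of_injOn (fun v ↦ v.asIdeal) (fun v hv ↦ hv) (fun v _ v' _ h ↦ HeightOneSpectrum.ext h)
      (IsDedekindDomain.primesOver_finite _ _)
  calc {v : HeightOneSpectrum (𝓞 F) | a ∈ v.asIdeal}.ncard
      ≤ (⋃ ℓ : N.natAbs.primeFactors, {v : HeightOneSpectrum (𝓞 F) |
          v.asIdeal ∈ (Ideal.span {((ℓ : ℕ) : ℤ)}).primesOver (𝓞 F)}).ncard :=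
        Set.ncard_le_ncard hcover (Set.finite_iUnion hfin)
    _ ≤ ∑ ℓ : N.natAbs.primeFactors, {v : HeightOneSpectrum (𝓞 F) |
          v.asIdeal ∈ (Ideal.span {((ℓ : ℕ) : ℤ)}).primesOver (𝓞 F)}.ncard := Set.ncard_iUnion_le_of_fintype _
    _ ≤ ∑ ℓ : N.natAbs.primeFactors, ((Ideal.span {((ℓ : ℕ) : ℤ)}).primesOver (𝓞 F)).ncard := Finset.sum_le_sum fun ℓ _ ↦ hle ℓ
    _ = ∑ ℓ ∈ N.natAbs.primeFactors, ((Ideal.span {(ℓ : ℤ)}).primesOver (𝓞 F)).ncard :=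
        Finset.sum_coe_sort _ (fun ℓ : ℕ ↦ ((Ideal.span {(ℓ : ℤ)}).primesOver (𝓞 F)).ncard)

/-! ## §3 Primes over `ℓ` along a finite extension -/

/-- **`#{primes of F over ℓ} ≤ [F : F₀] · #{primes of F₀ over ℓ}`**: every prime of `F` over `ℓ` lies over a prime of `F₀` over `ℓ`, and at most
`[F : F₀]` primes of `F` lie over a given prime of `F₀` (`Σ eᵢ fᵢ = [F : F₀]`). [cite: NeukirchANT1999, Ch. I §8 Prop. (8.2)] -/
theorem ncard_primesOver_le_finrank_mul (F₀ F : Type*) [Field F₀] [NumberField F₀] [Field F] [NumberField F] [Algebra F₀ F]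
    {ℓ : ℕ} (hℓ : ℓ.Prime) :
    ((Ideal.span {(ℓ : ℤ)}).primesOver (𝓞 F)).ncard ≤
      Module.finrank F₀ F * ((Ideal.span {(ℓ : ℤ)}).primesOver (𝓞 F₀)).ncard := by
  haveI : Fact ℓ.Prime := ⟨hℓ⟩
  haveI : (Ideal.span {(ℓ : ℤ)}).IsMaximal := Int.ideal_span_isMaximal_of_prime ℓ
  -- fibre over each prime `w` of `F₀`
  have hcover : (Ideal.span {(ℓ : ℤ)}).primesOver (𝓞 F) ⊆
      ⋃ w : (Ideal.span {(ℓ : ℤ)}).primesOver (𝓞 F₀), (w : Ideal (𝓞 F₀)).primesOver (𝓞 F) := by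
    intro Q hQ
    haveI := hQ.1
    haveI := hQ.2
    have hw : Q.under (𝓞 F₀) ∈ (Ideal.span {(ℓ : ℤ)}).primesOver (𝓞 F₀) :=
      ⟨Ideal.IsPrime.under _ Q, Ideal.LiesOver.tower_bot Q (Q.under (𝓞 F₀)) (Ideal.span {(ℓ : ℤ)})⟩
    exact Set.mem_iUnion.mpr ⟨⟨_, hw⟩, hQ.1, ⟨rfl⟩⟩
  haveI : Finite ((Ideal.span {(ℓ : ℤ)}).primesOver (𝓞 F₀)) := (IsDedekindDomain.primesOver_finite _ _).to_subtype
  haveI : Fintype ((Ideal.span {(ℓ : ℤ)}).primesOver (𝓞 F₀)) := Fintype.ofFinite _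
  have hfib : ∀ w : (Ideal.span {(ℓ : ℤ)}).primesOver (𝓞 F₀),
      ((w : Ideal (𝓞 F₀)).primesOver (𝓞 F)).ncard ≤ Module.finrank F₀ F := fun w ↦ by
    haveI : (w : Ideal (𝓞 F₀)).IsPrime := w.2.1
    have hw0 : (w : Ideal (𝓞 F₀)) ≠ ⊥ := by
      intro h0
      have h1 : (Ideal.span {(ℓ : ℤ)}) = ⊥ := by
        have := w.2.2.over
        rw [h0, Ideal.under_def, Ideal.comap_bot_of_injective _ (algebraMap ℤ (𝓞 F₀)).injective_int] at this
        exact this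
      rw [Ideal.span_singleton_eq_bot] at h1
      exact hℓ.ne_zero (by exact_mod_cast h1)
    haveI : (w : Ideal (𝓞 F₀)).IsMaximal := Ideal.IsPrime.isMaximal w.2.1 hw0
    haveI : NoZeroSMulDivisors (𝓞 F₀) (𝓞 F) := ⟨fun {c x} h => by
      rw [Algebra.smul_def, mul_eq_zero] at h
      exact h.imp_left fun hc =>
        FaithfulSMul.algebraMap_injective (𝓞 F₀) (𝓞 F) (by rw [hc, map_zero])⟩
    rw [← IsDedekindDomain.coe_primesOverFinset hw0 (𝓞 F), Set.ncard_coe_finset]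
    exact Ideal.card_primesOverFinset_le_finrank (𝓞 F) F₀ F hw0
  calc ((Ideal.span {(ℓ : ℤ)}).primesOver (𝓞 F)).ncard
      ≤ (⋃ w : (Ideal.span {(ℓ : ℤ)}).primesOver (𝓞 F₀), (w : Ideal (𝓞 F₀)).primesOver (𝓞 F)).ncard :=
        Set.ncard_le_ncard hcover (Set.finite_iUnion fun w ↦ IsDedekindDomain.primesOver_finite _ _)
    _ ≤ ∑ w : (Ideal.span {(ℓ : ℤ)}).primesOver (𝓞 F₀), ((w : Ideal (𝓞 F₀)).primesOver (𝓞 F)).ncard :=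
        Set.ncard_iUnion_le_of_fintype _
    _ ≤ ∑ _w : (Ideal.span {(ℓ : ℤ)}).primesOver (𝓞 F₀), Module.finrank F₀ F := Finset.sum_le_sum fun w _ ↦ hfib w
    _ = Module.finrank F₀ F * ((Ideal.span {(ℓ : ℤ)}).primesOver (𝓞 F₀)).ncard := by
        rw [Finset.sum_const, Finset.card_univ, smul_eq_mul, mul_comm, ← Nat.card_eq_fintype_card, Nat.card_coe_set_eq]

end Literature.NumberTheory.NumberFields

end
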